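import Summits.Ventures.CertifiedArithmetic.LowPrec.ExactNecessary

/-!
# THEOREMS-R1 Theorem P as a criterion: the necessary side, for every format triple

HONEST FRAMING (venture CertifiedArithmetic / cell `pub-lowprec`): certified error envelopes and
provably optimal rounding/accumulation schemes for low-precision formats under stated cost models;
every table by two implementations; no hardware or vendor claims.

`TheoremsR1.lean` proves Theorem P (`theoremP_holds`: (i) `P_R ≥ P_X + P_Y`, (ii)
`qexp_R ≤ qexp_X + qexp_Y`, (iii) `maxRat_X · maxRat_Y ≤ maxRat_R` imply `R2_ExactProducts`) and
`ExactCriteria.lean` the witness principles `not_exactProducts_of_witness` / `_of_overflow`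
(Theorems P′, P″), instantiated per key elsewhere. This def-free file quantifies the NECESSARY
side over the formats:

* `not_exactProducts_of_qexp_lt` — (ii) is necessary (product of the two least positive values;
  operand formats with a nonzero value) = Theorem P″(b) over formats;
* `not_exactProducts_of_maxRat_lt` — (iii) is necessary (product of the maxima) = Theorem P′;
* `not_exactProducts_of_odd_witness` — Theorem P″(a) over formats: values `a·2^i ∈ F_X`,
  `b·2^j ∈ F_Y` with `a`, `b` odd and `a b ≥ 2^P_R` refute exact products;
* `not_exactProducts_of_prec_lt` — (i) is necessary for operand formats of precision `≥ 2` that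
  contain their all-ones significand `2^P − 1` (i.e. `2^P − 1 ≤ maxScaled`; every named format
  does): the product `(2^P_X − 1)(2^P_Y − 1) · 2^(qexp_X + qexp_Y)` has an odd significand of
  `P_X + P_Y` bits (`pow_le_predPow_mul_predPow`: `(2^P_X − 1)(2^P_Y − 1) ≥ 2^(P_X + P_Y − 1)`);
* `exactProducts_iff` — THEOREM P IS A CRITERION: for such operand formats,
  `R2_ExactProducts X Y R ↔ (i) ∧ (ii) ∧ (iii)`.

Precision-1 operand formats are genuinely exceptional for (i): their values are powers of two, so
`P_R ≥ P_Y` already suffices — hence the hypotheses `1 ≤ manBits`.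
-/

namespace Summit.Ventures.CertifiedArithmetic

open Literature.ComputerArithmetic.FloatingPoint
open Literature.ComputerArithmetic.FloatingPoint.MiniFloat
open Literature.ComputerArithmetic.FloatingPoint.Format

/-- The value of `ofScaled` at a magnitude below `2^P` (always representable within range).
[folklore] -/
theorem toRat_ofScaled_of_lt_pow {φ : Format} {n : ℕ} (hn : n < 2 ^ (φ.manBits + 1))
    (hle : n ≤ φ.maxScaled) : (ofScaled φ false n hle).toRat = (n : ℚ) * 2 ^ φ.qexp := by
  rw [toRat_ofScaled hle (representable_of_lt_pow hn hle)]
  simp [Format.quantum]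

/-- Hypothesis (ii) of Theorem P is NECESSARY, every triple (Theorem P″(b) over formats): if both
operand formats have a nonzero value and `qexp_X + qexp_Y < qexp_R`, the product of the two least
positive values, `2^(qexp_X + qexp_Y)`, is not a value of `R`. -/
theorem not_exactProducts_of_qexp_lt {φ₁ φ₂ ψ : Format} (h₁ : 1 ≤ φ₁.maxScaled)
    (h₂ : 1 ≤ φ₂.maxScaled) (hq : φ₁.qexp + φ₂.qexp < ψ.qexp) : ¬ R2_ExactProducts φ₁ φ₂ ψ := by
  refine not_exactProducts_of_witness (ofScaled φ₁ false 1 h₁) (ofScaled φ₂ false 1 h₂) 1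
    (φ₁.qexp + φ₂.qexp) odd_one ?_ (Or.inl hq)
  rw [toRat_ofScaled_one h₁, toRat_ofScaled_one h₂, ← zpow_add₀ (two_ne_zero : (2 : ℚ) ≠ 0)]
  simp

/-- Hypothesis (iii) of Theorem P is NECESSARY, every triple (Theorem P′ over formats): if
`maxRat_X · maxRat_Y > maxRat_R` the product of the maxima overflows `R`. -/
theorem not_exactProducts_of_maxRat_lt {φ₁ φ₂ ψ : Format}
    (h : ψ.maxRat < φ₁.maxRat * φ₂.maxRat) : ¬ R2_ExactProducts φ₁ φ₂ ψ :=
  not_exactProducts_of_overflow (ofScaled φ₁ false φ₁.maxScaled le_rfl)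
    (ofScaled φ₂ false φ₂.maxScaled le_rfl)
    (by rwa [toRat_ofScaled_maxScaled, toRat_ofScaled_maxScaled])

/-- Theorem P″(a) over formats: values `x = a · 2^i`, `y = b · 2^j` with `a`, `b` odd and
`a b ≥ 2^P_R` refute exact products (the product has the odd significand `a b` of more than `P_R`
bits; `not_exactProducts_of_witness`). -/
theorem not_exactProducts_of_odd_witness {φ₁ φ₂ ψ : Format} (x : MiniFloat φ₁) (y : MiniFloat φ₂)
    {a b : ℕ} {i j : ℤ} (ha : Odd a) (hb : Odd b) (hx : x.toRat = (a : ℚ) * 2 ^ i)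
    (hy : y.toRat = (b : ℚ) * 2 ^ j) (hab : 2 ^ (ψ.manBits + 1) ≤ a * b) :
    ¬ R2_ExactProducts φ₁ φ₂ ψ := by
  refine not_exactProducts_of_witness x y (a * b) (i + j) (ha.mul hb) ?_ (Or.inr hab)
  rw [hx, hy, zpow_add₀ (two_ne_zero : (2 : ℚ) ≠ 0)]
  push_cast
  ring

/-- The all-ones significands multiply to at least half the full product range:
`(2^P₁ − 1)(2^P₂ − 1) ≥ 2^(P₁ + P₂ − 1) ≥ 2^R` for `P₁, P₂ ≥ 2` and `R < P₁ + P₂`. [folklore] -/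
theorem pow_le_predPow_mul_predPow {P₁ P₂ R : ℕ} (h₁ : 2 ≤ P₁) (h₂ : 2 ≤ P₂) (h : R < P₁ + P₂) :
    2 ^ R ≤ (2 ^ P₁ - 1) * (2 ^ P₂ - 1) := by
  obtain ⟨p, rfl⟩ := Nat.exists_eq_add_of_le h₁
  obtain ⟨q, rfl⟩ := Nat.exists_eq_add_of_le h₂
  have hR : 2 ^ R ≤ 2 ^ (p + q + 3) := Nat.pow_le_pow_right (by norm_num) (by omega)
  refine hR.trans ?_
  have hp : 1 ≤ 2 ^ (2 + p) := Nat.one_le_two_pow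
  have hq : 1 ≤ 2 ^ (2 + q) := Nat.one_le_two_pow
  have hX : (1 : ℤ) ≤ 2 ^ p := by exact_mod_cast Nat.one_le_two_pow
  have hY : (1 : ℤ) ≤ 2 ^ q := by exact_mod_cast Nat.one_le_two_pow
  zify [hp, hq]
  have e0 : (2 : ℤ) ^ (p + q + 3) = 8 * 2 ^ p * 2 ^ q := by ring
  have e1 : (2 : ℤ) ^ (2 + p) = 4 * 2 ^ p := by ring
  have e2 : (2 : ℤ) ^ (2 + q) = 4 * 2 ^ q := by ring
  rw [e0, e1, e2]
  nlinarith [mul_nonneg (sub_nonneg.mpr hX) (sub_nonneg.mpr hY), hX, hY]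

/-- Hypothesis (i) of Theorem P is NECESSARY for operand formats of precision `≥ 2` containing their
all-ones significand (`2^P − 1 ≤ maxScaled`), every destination: if `P_R < P_X + P_Y` then
`(2^P_X − 1) · 2^qexp_X` times `(2^P_Y − 1) · 2^qexp_Y` is not a value of `R`. -/
theorem not_exactProducts_of_prec_lt {φ₁ φ₂ ψ : Format} (hm₁ : 1 ≤ φ₁.manBits)
    (hm₂ : 1 ≤ φ₂.manBits) (h₁ : 2 ^ (φ₁.manBits + 1) - 1 ≤ φ₁.maxScaled)
    (h₂ : 2 ^ (φ₂.manBits + 1) - 1 ≤ φ₂.maxScaled)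
    (hP : ψ.manBits < φ₁.manBits + φ₂.manBits + 1) : ¬ R2_ExactProducts φ₁ φ₂ ψ := by
  have hlt₁ : 2 ^ (φ₁.manBits + 1) - 1 < 2 ^ (φ₁.manBits + 1) := Nat.sub_lt (by positivity) one_pos
  have hlt₂ : 2 ^ (φ₂.manBits + 1) - 1 < 2 ^ (φ₂.manBits + 1) := Nat.sub_lt (by positivity) one_pos
  have hodd : ∀ n : ℕ, 1 ≤ n → Odd (2 ^ n - 1) := fun n hn =>
    Nat.Even.sub_odd Nat.one_le_two_pow (Nat.even_pow.mpr ⟨even_two, by omega⟩) odd_one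
  refine not_exactProducts_of_odd_witness (ofScaled φ₁ false _ h₁) (ofScaled φ₂ false _ h₂)
    (hodd _ (by omega)) (hodd _ (by omega)) (toRat_ofScaled_of_lt_pow hlt₁ h₁)
    (toRat_ofScaled_of_lt_pow hlt₂ h₂) ?_
  exact pow_le_predPow_mul_predPow (by omega) (by omega) (by omega)

/-- THEOREM P IS A CRITERION (every destination; operand formats of precision `≥ 2` containing their
all-ones significand — every named format does): exact products into `R` for all pairs of values
`↔` (i) `P_R ≥ P_X + P_Y` ∧ (ii) `qexp_R ≤ qexp_X + qexp_Y` ∧ (iii) `maxRat_X · maxRat_Y ≤ maxRat_R`.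
The `←` direction is `theoremP_holds` (TheoremsR1.lean). -/
theorem exactProducts_iff {φ₁ φ₂ ψ : Format} (hm₁ : 1 ≤ φ₁.manBits) (hm₂ : 1 ≤ φ₂.manBits)
    (h₁ : 2 ^ (φ₁.manBits + 1) - 1 ≤ φ₁.maxScaled) (h₂ : 2 ^ (φ₂.manBits + 1) - 1 ≤ φ₂.maxScaled) :
    R2_ExactProducts φ₁ φ₂ ψ ↔
      φ₁.manBits + φ₂.manBits + 1 ≤ ψ.manBits ∧ ψ.qexp ≤ φ₁.qexp + φ₂.qexp ∧
        φ₁.maxRat * φ₂.maxRat ≤ ψ.maxRat := by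
  have hS₁ : 1 ≤ φ₁.maxScaled :=
    le_trans (Nat.le_sub_one_of_lt (Nat.one_lt_two_pow (by omega))) h₁
  have hS₂ : 1 ≤ φ₂.maxScaled :=
    le_trans (Nat.le_sub_one_of_lt (Nat.one_lt_two_pow (by omega))) h₂
  constructor
  · intro h
    refine ⟨?_, ?_, ?_⟩
    · by_contra hlt
      exact not_exactProducts_of_prec_lt hm₁ hm₂ h₁ h₂ (by omega) h
    · by_contra hlt
      exact not_exactProducts_of_qexp_lt hS₁ hS₂ (by omega) h
    · by_contra hlt
      exact not_exactProducts_of_maxRat_lt (not_le.mp hlt) h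
  · rintro ⟨hP, hL, hM⟩
    exact theoremP_holds φ₁ φ₂ ψ hP hL hM

/-- The criterion decides keys by their parameters alone, e.g. `e3m2 · e3m2 → e3m2` is inexact
because (i) fails (`3 + 3 > 3`) — no witness search, no enumeration. -/
example : ¬ R2_ExactProducts E3M2 E3M2 E3M2 := fun h =>
  absurd ((exactProducts_iff (by decide) (by decide) (by decide) (by decide)).mp h).1 (by decide)

/-- … and `e2m1 · e2m3 → e2m3` is inexact for the same reason (`2 + 4 > 4`). -/
example : ¬ R2_ExactProducts E2M1 E2M3 E2M3 := fun h =>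
  absurd ((exactProducts_iff (by decide) (by decide) (by decide) (by decide)).mp h).1 (by decide)

end Summit.Ventures.CertifiedArithmetic
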